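import Mathlib.Algebra.Order.Chebyshev
import Mathlib.Data.Finset.Prod
import Mathlib.Algebra.Order.BigOperators.Ring.Finset
import Mathlib.Tactic
import HarnessLib

/-!
# Cauchy–Schwarz counting inequalities ("additive energy" in physical space)

Topic `NumberTheory/DiophantineGeometry`; first of the auxiliary files for the proof of
`Literature.NumberTheory.DiophantineGeometry.bernertEtAl2024_thm_1_2`
(Bernert–Browning–Lichtman–Teräväinen, *Bounds on the exceptional set in the abc conjecture*,
arXiv:2410.12234 v2, Theorem 1.2), assembled in `AbcExceptionalSetBoundsProofs`.

The source bounds the number `T` of solutions of `F x + G y = H z` (`x ∈ 𝒳`, `y ∈ 𝒴`, `z ∈ 𝒵`)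
by Fourier analysis: orthogonality, Hölder, and the interpolation `∫|S|³ ≤ (∫|S|²)^{1/2}(∫|S|⁴)^{1/2}`
[cite: Bernert2025, Prop. 3] = [cite: BernertEtAl2024, Prop. 3.1 (arXiv v2)]. Here the same
inequality is proved in physical space, where it is two applications of Cauchy–Schwarz to
representation functions and needs no analysis:

* `sq_card_le_card_mul_card_of_injOn`: if every `s ∈ S` yields `φ (a s) = ψ (b s)` injectively,
  then `#S² ≤ #{φ a = φ a'} · #{ψ b = ψ b'}` (the sum `∑ₙ r(n) s(n)` against `∑ r², ∑ s²`);
* `card_pairs_le_card_mul_card_keyed`: `#{Φ p = Φ q} ≤ #K · #{Φ p = Φ q ∧ κ p = κ q}` for a key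
  `κ` with values in `K` (Cauchy–Schwarz `(∑ₖ Rₖ)² ≤ #K ∑ₖ Rₖ²` fibrewise) — the physical-space form
  of the pointwise bound `|S(α)|² ≤ #K · ∑ₖ |Sₖ(α)|²` used for the fourth moment in the source;
* `card_solutions_pow_six_le`: `T⁶ ≤ E₂(F) E₂(G) E₂(H) · E₄(F) E₄(G) E₄(H)` with
  `E₂(F) = #{F x = F x'}` and `E₄(F) = #{F x − F x' = F x'' − F x'''}`.

Everything is stated for finsets of arbitrary types and integer-valued maps; no definitions are
introduced (the energies appear as explicit `Finset.card` expressions).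
-/

open Finset

namespace Literature.NumberTheory.DiophantineGeometry

namespace AbcExceptional

/-! ### Fibrewise decomposition of equal-value pair counts -/

section Fibre

variable {σ τ δ : Type*} [DecidableEq δ]

/-- `#{(a, b) ∈ S × T : f a = g b} = ∑ₙ #{a : f a = n} · #{b : g b = n}`, the sum running over any
finset containing the values of `f` on `S`. [folklore] -/
theorem card_filter_prod_eq_sum (S : Finset σ) (T : Finset τ) (f : σ → δ) (g : τ → δ)
    (U : Finset δ) (hU : ∀ a ∈ S, f a ∈ U) :
    #{p ∈ S ×ˢ T | f p.1 = g p.2} = ∑ n ∈ U, #{a ∈ S | f a = n} * #{b ∈ T | g b = n} := by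
  classical
  rw [card_eq_sum_card_fiberwise (f := fun p : σ × τ => f p.1) (t := U)
    (fun p hp => hU p.1 (mem_product.mp (mem_filter.mp hp).1).1)]
  refine sum_congr rfl (fun n _ => ?_)
  rw [← card_product]
  congr 1
  ext ⟨a, b⟩
  simp only [mem_filter, mem_product]
  constructor
  · rintro ⟨⟨⟨ha, hb⟩, hfg⟩, hfn⟩
    exact ⟨⟨ha, hfn⟩, hb, by rw [← hfg, hfn]⟩
  · rintro ⟨⟨ha, hfn⟩, hb, hgn⟩
    exact ⟨⟨⟨ha, hb⟩, by rw [hfn, hgn]⟩, hfn⟩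

end Fibre

/-! ### Cauchy–Schwarz for equal-value pair counts -/

section CS

variable {σ α β δ : Type*} [DecidableEq δ]

/-- **Cauchy–Schwarz for representation functions.** If `s ↦ (a s, b s)` is injective on `S` with
`a s ∈ A`, `b s ∈ B` and `φ (a s) = ψ (b s)`, then
`#S² ≤ #{(a, a') ∈ A² : φ a = φ a'} · #{(b, b') ∈ B² : ψ b = ψ b'}`.
(`#S ≤ ∑ₙ r(n) s(n) ≤ (∑ r²)^{1/2} (∑ s²)^{1/2}`.) [folklore] -/
theorem sq_card_le_card_mul_card_of_injOn (S : Finset σ) (A : Finset α) (B : Finset β)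
    (a : σ → α) (b : σ → β) (φ : α → δ) (ψ : β → δ)
    (ha : ∀ s ∈ S, a s ∈ A) (hb : ∀ s ∈ S, b s ∈ B)
    (hinj : Set.InjOn (fun s => (a s, b s)) S) (heq : ∀ s ∈ S, φ (a s) = ψ (b s)) :
    #S ^ 2 ≤ #{p ∈ A ×ˢ A | φ p.1 = φ p.2} * #{p ∈ B ×ˢ B | ψ p.1 = ψ p.2} := by
  classical
  set U : Finset δ := A.image φ ∪ B.image ψ with hU
  have hUA : ∀ x ∈ A, φ x ∈ U := fun x hx => mem_union_left _ (mem_image_of_mem φ hx)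
  have hUB : ∀ y ∈ B, ψ y ∈ U := fun y hy => mem_union_right _ (mem_image_of_mem ψ hy)
  have hS : #S ≤ #{p ∈ A ×ˢ B | φ p.1 = ψ p.2} := by
    refine card_le_card_of_injOn (fun s => (a s, b s)) (fun s hs => ?_) hinj
    simp only [coe_filter, mem_product, Set.mem_setOf_eq]
    exact ⟨⟨ha s hs, hb s hs⟩, heq s hs⟩
  have h1 := card_filter_prod_eq_sum A B φ ψ U hUA
  have h2 := card_filter_prod_eq_sum A A φ φ U hUA
  have h3 := card_filter_prod_eq_sum B B ψ ψ U hUB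
  calc #S ^ 2 ≤ #{p ∈ A ×ˢ B | φ p.1 = ψ p.2} ^ 2 := Nat.pow_le_pow_left hS 2
    _ = (∑ n ∈ U, #{x ∈ A | φ x = n} * #{y ∈ B | ψ y = n}) ^ 2 := by rw [h1]
    _ ≤ (∑ n ∈ U, #{x ∈ A | φ x = n} ^ 2) * ∑ n ∈ U, #{y ∈ B | ψ y = n} ^ 2 :=
        sum_mul_sq_le_sq_mul_sq U _ _
    _ = #{p ∈ A ×ˢ A | φ p.1 = φ p.2} * #{p ∈ B ×ˢ B | ψ p.1 = ψ p.2} := by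
        rw [h2, h3]
        simp only [sq]

/-- **Keyed Cauchy–Schwarz.** For a key `κ` on `A` with values in `K`,
`#{(p, q) ∈ A² : Φ p = Φ q} ≤ #K · #{(p, q) ∈ A² : Φ p = Φ q ∧ κ p = κ q}`: fibrewise over the
value `n = Φ p`, `(∑ₖ Rₖ(n))² ≤ #K ∑ₖ Rₖ(n)²`. [folklore] -/
theorem card_pairs_le_card_mul_card_keyed {K : Type*} [DecidableEq K] (A : Finset σ) (Φ : σ → δ)
    (κ : σ → K) (Kf : Finset K) (hK : ∀ p ∈ A, κ p ∈ Kf) :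
    #{pq ∈ A ×ˢ A | Φ pq.1 = Φ pq.2} ≤
      #Kf * #{pq ∈ A ×ˢ A | Φ pq.1 = Φ pq.2 ∧ κ pq.1 = κ pq.2} := by
  classical
  set U : Finset δ := A.image Φ with hU
  have hUA : ∀ x ∈ A, Φ x ∈ U := fun x hx => mem_image_of_mem Φ hx
  have h1 := card_filter_prod_eq_sum A A Φ Φ U hUA
  -- the keyed count, fibred over `(Φ p, κ p) ∈ U ×ˢ Kf`
  have hUK : ∀ x ∈ A, (Φ x, κ x) ∈ U ×ˢ Kf := fun x hx => mem_product.mpr ⟨hUA x hx, hK x hx⟩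
  have h2 := card_filter_prod_eq_sum A A (fun x => (Φ x, κ x)) (fun x => (Φ x, κ x)) (U ×ˢ Kf) hUK
  have h2' : #{pq ∈ A ×ˢ A | Φ pq.1 = Φ pq.2 ∧ κ pq.1 = κ pq.2} =
      #{pq ∈ A ×ˢ A | (Φ pq.1, κ pq.1) = (Φ pq.2, κ pq.2)} := by
    congr 1
    ext pq
    simp only [mem_filter, Prod.mk.injEq]
  rw [h2', h2, h1, sum_product, mul_sum]
  refine sum_le_sum (fun n _ => ?_)
  -- `R(n) = ∑ₖ Rₖ(n)` and Cauchy–Schwarz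
  have hR : #{x ∈ A | Φ x = n} = ∑ k ∈ Kf, #{x ∈ A | (Φ x, κ x) = (n, k)} := by
    rw [card_eq_sum_card_fiberwise (f := κ) (t := Kf) (fun x hx => hK x (mem_filter.mp hx).1)]
    refine sum_congr rfl (fun k _ => ?_)
    congr 1
    ext x
    simp only [mem_filter, Prod.mk.injEq, and_assoc]
  rw [hR]
  calc (∑ k ∈ Kf, #{x ∈ A | (Φ x, κ x) = (n, k)}) * ∑ k ∈ Kf, #{x ∈ A | (Φ x, κ x) = (n, k)}
        = (∑ k ∈ Kf, #{x ∈ A | (Φ x, κ x) = (n, k)}) ^ 2 := (sq _).symm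
    _ ≤ #Kf * ∑ k ∈ Kf, #{x ∈ A | (Φ x, κ x) = (n, k)} ^ 2 := sq_sum_le_card_mul_sum_sq
    _ = #Kf * ∑ k ∈ Kf, #{x ∈ A | (Φ x, κ x) = (n, k)} * #{x ∈ A | (Φ x, κ x) = (n, k)} := by
        simp only [sq]

end CS

/-! ### The sixth-power bound for `F x + G y = H z` -/

section T6

variable {α β γ : Type*}

/-- First splitting: `T² ≤ E₂(F) · #{H z − G y = H z' − G y'}`. [folklore] -/
theorem sq_card_solutions_le_F (X : Finset α) (Y : Finset β) (Z : Finset γ)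
    (F : α → ℤ) (G : β → ℤ) (H : γ → ℤ) :
    #{t ∈ X ×ˢ (Y ×ˢ Z) | F t.1 + G t.2.1 = H t.2.2} ^ 2 ≤
      #{p ∈ X ×ˢ X | F p.1 = F p.2} *
        #{q ∈ (Y ×ˢ Z) ×ˢ (Y ×ˢ Z) | H q.1.2 - G q.1.1 = H q.2.2 - G q.2.1} := by
  refine sq_card_le_card_mul_card_of_injOn _ X (Y ×ˢ Z) (fun t => t.1) (fun t => t.2) F
    (fun yz => H yz.2 - G yz.1) (fun t ht => ?_) (fun t ht => ?_) (fun t _ t' _ h => ?_)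
    (fun t ht => ?_)
  · exact (mem_product.mp (mem_filter.mp ht).1).1
  · exact (mem_product.mp (mem_filter.mp ht).1).2
  · simpa only [Prod.mk.injEq, Prod.ext_iff] using h
  · have := (mem_filter.mp ht).2
    show F t.1 = H t.2.2 - G t.2.1
    linarith

/-- Second splitting: `T² ≤ E₂(G) · #{H z − F x = H z' − F x'}`. [folklore] -/
theorem sq_card_solutions_le_G (X : Finset α) (Y : Finset β) (Z : Finset γ)
    (F : α → ℤ) (G : β → ℤ) (H : γ → ℤ) :
    #{t ∈ X ×ˢ (Y ×ˢ Z) | F t.1 + G t.2.1 = H t.2.2} ^ 2 ≤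
      #{p ∈ Y ×ˢ Y | G p.1 = G p.2} *
        #{q ∈ (X ×ˢ Z) ×ˢ (X ×ˢ Z) | H q.1.2 - F q.1.1 = H q.2.2 - F q.2.1} := by
  refine sq_card_le_card_mul_card_of_injOn _ Y (X ×ˢ Z) (fun t => t.2.1) (fun t => (t.1, t.2.2))
    G (fun xz => H xz.2 - F xz.1) (fun t ht => ?_) (fun t ht => ?_) (fun t _ t' _ h => ?_)
    (fun t ht => ?_)
  · exact (mem_product.mp (mem_product.mp (mem_filter.mp ht).1).2).1
  · have h := mem_product.mp (mem_filter.mp ht).1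
    exact mem_product.mpr ⟨h.1, (mem_product.mp h.2).2⟩
  · simp only [Prod.mk.injEq] at h
    exact Prod.ext h.2.1 (Prod.ext h.1 h.2.2)
  · have := (mem_filter.mp ht).2
    show G t.2.1 = H t.2.2 - F t.1
    linarith

/-- Third splitting: `T² ≤ E₂(H) · #{F x + G y = F x' + G y'}`, the latter written as
`#{F x − F x' = G y' − G y}` over `X² × Y²`. [folklore] -/
theorem sq_card_solutions_le_H (X : Finset α) (Y : Finset β) (Z : Finset γ)
    (F : α → ℤ) (G : β → ℤ) (H : γ → ℤ) :
    #{t ∈ X ×ˢ (Y ×ˢ Z) | F t.1 + G t.2.1 = H t.2.2} ^ 2 ≤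
      #{p ∈ Z ×ˢ Z | H p.1 = H p.2} *
        #{q ∈ (X ×ˢ Y) ×ˢ (X ×ˢ Y) | F q.1.1 + G q.1.2 = F q.2.1 + G q.2.2} := by
  refine sq_card_le_card_mul_card_of_injOn _ Z (X ×ˢ Y) (fun t => t.2.2) (fun t => (t.1, t.2.1))
    H (fun xy => F xy.1 + G xy.2) (fun t ht => ?_) (fun t ht => ?_) (fun t _ t' _ h => ?_)
    (fun t ht => ?_)
  · exact (mem_product.mp (mem_product.mp (mem_filter.mp ht).1).2).2
  · have h := mem_product.mp (mem_filter.mp ht).1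
    exact mem_product.mpr ⟨h.1, (mem_product.mp h.2).1⟩
  · simp only [Prod.mk.injEq] at h
    exact Prod.ext h.2.1 (Prod.ext h.2.2 h.1)
  · have := (mem_filter.mp ht).2
    show H t.2.2 = F t.1 + G t.2.1
    linarith

/-- Mixed energies are bounded by the fourth-moment energies:
`#{H z − G y = H z' − G y'}² ≤ E₄(G) E₄(H)`. [folklore] -/
theorem sq_mixed_le_E4 (Y : Finset β) (Z : Finset γ) (G : β → ℤ) (H : γ → ℤ) :
    #{q ∈ (Y ×ˢ Z) ×ˢ (Y ×ˢ Z) | H q.1.2 - G q.1.1 = H q.2.2 - G q.2.1} ^ 2 ≤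
      #{q ∈ (Y ×ˢ Y) ×ˢ (Y ×ˢ Y) | G q.1.1 - G q.1.2 = G q.2.1 - G q.2.2} *
        #{q ∈ (Z ×ˢ Z) ×ˢ (Z ×ˢ Z) | H q.1.1 - H q.1.2 = H q.2.1 - H q.2.2} := by
  refine sq_card_le_card_mul_card_of_injOn _ (Y ×ˢ Y) (Z ×ˢ Z) (fun q => (q.1.1, q.2.1))
    (fun q => (q.1.2, q.2.2)) (fun p => G p.1 - G p.2) (fun p => H p.1 - H p.2)
    (fun q hq => ?_) (fun q hq => ?_) (fun q _ q' _ h => ?_) (fun q hq => ?_)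
  · have h := mem_product.mp (mem_filter.mp hq).1
    exact mem_product.mpr ⟨(mem_product.mp h.1).1, (mem_product.mp h.2).1⟩
  · have h := mem_product.mp (mem_filter.mp hq).1
    exact mem_product.mpr ⟨(mem_product.mp h.1).2, (mem_product.mp h.2).2⟩
  · simp only [Prod.mk.injEq] at h
    exact Prod.ext (Prod.ext h.1.1 h.2.1) (Prod.ext h.1.2 h.2.2)
  · have := (mem_filter.mp hq).2
    show G q.1.1 - G q.2.1 = H q.1.2 - H q.2.2
    linarith

/-- `#{F x + G y = F x' + G y'}² ≤ E₄(F) E₄(G)`. [folklore] -/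
theorem sq_mixed_le_E4' (X : Finset α) (Y : Finset β) (F : α → ℤ) (G : β → ℤ) :
    #{q ∈ (X ×ˢ Y) ×ˢ (X ×ˢ Y) | F q.1.1 + G q.1.2 = F q.2.1 + G q.2.2} ^ 2 ≤
      #{q ∈ (X ×ˢ X) ×ˢ (X ×ˢ X) | F q.1.1 - F q.1.2 = F q.2.1 - F q.2.2} *
        #{q ∈ (Y ×ˢ Y) ×ˢ (Y ×ˢ Y) | G q.1.1 - G q.1.2 = G q.2.1 - G q.2.2} := by
  refine sq_card_le_card_mul_card_of_injOn _ (X ×ˢ X) (Y ×ˢ Y) (fun q => (q.1.1, q.2.1))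
    (fun q => (q.2.2, q.1.2)) (fun p => F p.1 - F p.2) (fun p => G p.1 - G p.2)
    (fun q hq => ?_) (fun q hq => ?_) (fun q _ q' _ h => ?_) (fun q hq => ?_)
  · have h := mem_product.mp (mem_filter.mp hq).1
    exact mem_product.mpr ⟨(mem_product.mp h.1).1, (mem_product.mp h.2).1⟩
  · have h := mem_product.mp (mem_filter.mp hq).1
    exact mem_product.mpr ⟨(mem_product.mp h.2).2, (mem_product.mp h.1).2⟩
  · simp only [Prod.mk.injEq] at h
    exact Prod.ext (Prod.ext h.1.1 h.2.2) (Prod.ext h.1.2 h.2.1)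
  · have := (mem_filter.mp hq).2
    show F q.1.1 - F q.2.1 = G q.2.2 - G q.1.2
    linarith

/-- **The sixth-power bound** (physical-space form of Hölder + `∫|S|³ ≤ ‖S‖₂ ‖S‖₄²` in
[Bernert2025, proof of Prop. 3]): the number `T` of solutions of `F x + G y = H z` satisfies
`T⁶ ≤ E₂(F) E₂(G) E₂(H) · E₄(F) E₄(G) E₄(H)`. [cite: Bernert2025, Prop. 3] -/
theorem card_solutions_pow_six_le (X : Finset α) (Y : Finset β) (Z : Finset γ)
    (F : α → ℤ) (G : β → ℤ) (H : γ → ℤ) :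
    #{t ∈ X ×ˢ (Y ×ˢ Z) | F t.1 + G t.2.1 = H t.2.2} ^ 6 ≤
      (#{p ∈ X ×ˢ X | F p.1 = F p.2} * #{p ∈ Y ×ˢ Y | G p.1 = G p.2} *
        #{p ∈ Z ×ˢ Z | H p.1 = H p.2}) *
      (#{q ∈ (X ×ˢ X) ×ˢ (X ×ˢ X) | F q.1.1 - F q.1.2 = F q.2.1 - F q.2.2} *
        #{q ∈ (Y ×ˢ Y) ×ˢ (Y ×ˢ Y) | G q.1.1 - G q.1.2 = G q.2.1 - G q.2.2} *
        #{q ∈ (Z ×ˢ Z) ×ˢ (Z ×ˢ Z) | H q.1.1 - H q.1.2 = H q.2.1 - H q.2.2}) := by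
  -- names
  set T := #{t ∈ X ×ˢ (Y ×ˢ Z) | F t.1 + G t.2.1 = H t.2.2}
  set E2F := #{p ∈ X ×ˢ X | F p.1 = F p.2}
  set E2G := #{p ∈ Y ×ˢ Y | G p.1 = G p.2}
  set E2H := #{p ∈ Z ×ˢ Z | H p.1 = H p.2}
  set E4F := #{q ∈ (X ×ˢ X) ×ˢ (X ×ˢ X) | F q.1.1 - F q.1.2 = F q.2.1 - F q.2.2}
  set E4G := #{q ∈ (Y ×ˢ Y) ×ˢ (Y ×ˢ Y) | G q.1.1 - G q.1.2 = G q.2.1 - G q.2.2}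
  set E4H := #{q ∈ (Z ×ˢ Z) ×ˢ (Z ×ˢ Z) | H q.1.1 - H q.1.2 = H q.2.1 - H q.2.2}
  set MGH := #{q ∈ (Y ×ˢ Z) ×ˢ (Y ×ˢ Z) | H q.1.2 - G q.1.1 = H q.2.2 - G q.2.1}
  set MFH := #{q ∈ (X ×ˢ Z) ×ˢ (X ×ˢ Z) | H q.1.2 - F q.1.1 = H q.2.2 - F q.2.1}
  set MFG := #{q ∈ (X ×ˢ Y) ×ˢ (X ×ˢ Y) | F q.1.1 + G q.1.2 = F q.2.1 + G q.2.2}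
  have h1 : T ^ 2 ≤ E2F * MGH := sq_card_solutions_le_F X Y Z F G H
  have h2 : T ^ 2 ≤ E2G * MFH := sq_card_solutions_le_G X Y Z F G H
  have h3 : T ^ 2 ≤ E2H * MFG := sq_card_solutions_le_H X Y Z F G H
  have m1 : MGH ^ 2 ≤ E4G * E4H := sq_mixed_le_E4 Y Z G H
  have m2 : MFH ^ 2 ≤ E4F * E4H := sq_mixed_le_E4 X Z F H
  have m3 : MFG ^ 2 ≤ E4F * E4G := sq_mixed_le_E4' X Y F G
  have hM : (MGH * MFH * MFG) ^ 2 ≤ (E4F * E4G * E4H) ^ 2 := by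
    calc (MGH * MFH * MFG) ^ 2 = MGH ^ 2 * MFH ^ 2 * MFG ^ 2 := by ring
      _ ≤ (E4G * E4H) * (E4F * E4H) * (E4F * E4G) :=
          Nat.mul_le_mul (Nat.mul_le_mul m1 m2) m3
      _ = (E4F * E4G * E4H) ^ 2 := by ring
  have hM' : MGH * MFH * MFG ≤ E4F * E4G * E4H := (Nat.pow_le_pow_iff_left (by norm_num)).mp hM
  calc T ^ 6 = T ^ 2 * T ^ 2 * T ^ 2 := by ring
    _ ≤ (E2F * MGH) * (E2G * MFH) * (E2H * MFG) := Nat.mul_le_mul (Nat.mul_le_mul h1 h2) h3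
    _ = (E2F * E2G * E2H) * (MGH * MFH * MFG) := by ring
    _ ≤ (E2F * E2G * E2H) * (E4F * E4G * E4H) := Nat.mul_le_mul_left _ hM'

end T6

end AbcExceptional

end Literature.NumberTheory.DiophantineGeometry
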